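import Literature.NumberTheory.Automorphic.DiscreteAutomorphicRepArchModule
import Literature.NumberTheory.Automorphic.UnitaryGroupCohomologicalForms
import Literature.RepresentationTheory.KonnoKonno2007.RealUnitaryDualPairRelabel
import Literature.RepresentationTheory.KonnoKonno2007.JunctionLinearRealGroup
import HarnessLib

/-!
# The archimedean `(𝔤, K)`-module of a discrete automorphic representation of a CM unitary group `U(H)`,
# `H ∈ M₃(L)` of signature `(2,1)` at `ι`, in the `U(2,1)_{Fin 2 ⊕ Fin 1}` currency

Topic `NumberTheory/Automorphic`; namespace `Literature.NumberTheory.Automorphic`.  DEFINITIONS WITH BODIES (one frame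
isomorphism, one homomorphism, four `abbrev` specialisations) + proved structural lemmas; no named fact, no instance, no
notation, no `sorry`.  Companion of ★ `DiscreteAutomorphicRepArchModule` (the GENERIC construction
`P.archModule G ιG`); this file is its SPECIALISATION for the floor-0 programmes P2a / P4a / P3b of cell
hodgecm-mathlib (item D4: «ONE currency, the `Unit ↔ Fin 1` reindex done ONCE, here»).

For a CM field `L` with maximal totally real subfield `L⁺`, an embedding `ι : L →+* ℂ`, a matrix `H ∈ M₃(L)` and a
frame `T ∈ GL₃(ℂ)` with `Tᴴ ι(H) T = diag(1, 1, −1)` (signature `(2,1)` at `ι`), the tree has the adelic group datum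
`UnitaryGroup.adelicGroupData L⁺ L c̄ 3 H` of `U(H)` (★ `AdelicUnitaryGroupDatum`) and the CM archimedean SECTION
`cmArchSection L ι H T hT : U21 →* U(H)(𝔸_{L⁺})` at `ι` (★ `UnitaryGroupCohomologicalForms`, = ★ `archSectionU21CM`),
where `U21 ≤ GL₃(ℂ)` is the ball-model `U(2,1)` (★ `UnitBallU21`).  The archimedean ENGINE of the cell (Borel–Wallach
`U(p, q)` layer, ★ `F0P3b*`, ★ `Upq*`) speaks `(𝔤, K)`-modules of the linear real group
`uFormGroup (Fin 2) (Fin 1) : RealMatrixGroup ℂ (Fin 2 ⊕ Fin 1)` (★ `JunctionLinearRealGroup`).  We set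

* §1 `RealDualPair.u21FrameEquivFin1 : U21 ≃ₜ* UForm (Fin 2) (Fin 1)` — the ball-model frame ★ `u21FrameEquiv :
  U21 ≃ₜ* UForm (Fin 2) Unit` followed by the relabelling `Unit ≃ Fin 1` (★ `UForm.relabel`); the matrix of the image
  is `reindex e e (mat g)` for the explicit `e = frameIdxFin1 : Fin 3 ≃ Fin 2 ⊕ Fin 1`;
* §2 `UnitaryGroup.cmArchSectionUForm L ι H T hT : (uFormGroup (Fin 2) (Fin 1)).carrier →* U(H)(𝔸_{L⁺})` — the CM
  archimedean section at `ι` precomposed with the inverse frame; continuous and injective;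
* §3 the specialisations `P.archRepCM ι T hT`, `P.archModuleCM ι T hT`, `P.archRepKCM ι T hT`, `P.archRepLieCM ι T hT`
  (`abbrev`s of the generic `archRep` / `archModule` / `archRepK` / `archRepLie` at `G := uFormGroup (Fin 2) (Fin 1)`,
  `ιG := cmArchSectionUForm L ι H T hT`), with `isGKModule_archModuleCM` and the unitarity identity
  `inner_archRepLieCM_add_inner_archRepLieCM_eq_zero` (the consumer's `IsUnitaryAlongP` is twenty lines from it with
  `B := Re ⟪·,·⟫`).

Source of the notions: Borel–Jacquet §4.3–4.6 (the `(𝔤, K_∞)`-module of an automorphic representation at an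
archimedean place); Borel–Wallach Ch. 0 §2.4–2.6.  Honest scope as in the generic file: `P.archModuleCM ι T hT` is
`π_ι`-isotypic, not irreducible.

## References

* A. Borel, H. Jacquet, *Automorphic forms and automorphic representations*, Proc. Sympos. Pure Math. 33.1 (1979),
  §4.3–4.6 [BorelJacquetCorvallis1979].
* A. Borel, N. Wallach, *Continuous Cohomology, Discrete Subgroups, and Representations of Reductive Groups*, 2nd ed.
  (2000), Ch. 0 §2.4–2.6 [BorelWallach2000].
* K. Konno, T. Konno, *On doubling construction for real unitary dual pairs*, Kyushu J. Math. 61 (2007), §3.1 (the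
  `U(p, q)` frames) [KonnoKonno2007].
-/

-- Mathlib idiom (Mathlib/Algebra/Lie/OfAssociative.lean; as in ★ `GKModules` and every `(𝔤, K)` file of the tree):
-- the commutator bracket on `Matrix N N A` and on `Module.End ℂ V`, needed to MENTION `G.lie →ₗ⁅ℝ⁆ Module.End ℂ _`.
attribute [local instance 100] LieRing.ofAssociativeRing

open NumberField MeasureTheory
open scoped Matrix InnerProductSpace MatrixGroups

noncomputable section

/-! ## §1 The frame `U21 ≃ₜ* U(2,1)_{Fin 2 ⊕ Fin 1}` -/

namespace Literature.RepresentationTheory.KonnoKonno2007.RealDualPair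

open Literature.Geometry.ComplexHyperbolic.BallModel (U21 mat)

/-- The reindexing `Fin 3 ≃ Fin 2 ⊕ Fin 1`: `0, 1 ↦ inl 0, inl 1`, `2 ↦ inr 0` (★ `frameIdx` followed by `Unit ≃ Fin 1`).
[cite: KonnoKonno2007, §3.1] -/
def frameIdxFin1 : Fin 3 ≃ Fin 2 ⊕ Fin 1 :=
  frameIdx.trans (Equiv.sumCongr (Equiv.refl (Fin 2)) finOneEquiv.symm)

/-- **The ball-model frame `U21 ≃ₜ* U(2,1)_{Fin 2 ⊕ Fin 1}`**: ★ `u21FrameEquiv : U21 ≃ₜ* UForm (Fin 2) Unit` followed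
by the relabelling `Unit ≃ Fin 1` (★ `UForm.relabel`) — the index convention of the cell's archimedean engine
(`uFormGroup (Fin 2) (Fin 1)`), fixed once here. [cite: KonnoKonno2007, §3.1] -/
def u21FrameEquivFin1 : U21 ≃ₜ* UForm (Fin 2) (Fin 1) :=
  u21FrameEquiv.trans (UForm.relabel (Fin 2) Unit (Fin 2) (Fin 1) (Equiv.refl (Fin 2)) finOneEquiv.symm)

/-- Matrix of `u21FrameEquivFin1 g`: `reindex frameIdxFin1 frameIdxFin1 (mat g)`. [cite: KonnoKonno2007, §3.1] -/
@[simp] theorem coe_u21FrameEquivFin1 (g : U21) :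
    (((u21FrameEquivFin1 g : UForm (Fin 2) (Fin 1)) : GL (Fin 2 ⊕ Fin 1) ℂ) : Matrix (Fin 2 ⊕ Fin 1) (Fin 2 ⊕ Fin 1) ℂ) =
      Matrix.reindex frameIdxFin1 frameIdxFin1 (mat g) := by
  ext x y
  rfl

/-- Entries of `u21FrameEquivFin1 g`: `(mat g) (frameIdxFin1⁻¹ x) (frameIdxFin1⁻¹ y)`. [cite: KonnoKonno2007, §3.1] -/
theorem coe_u21FrameEquivFin1_apply (g : U21) (x y : Fin 2 ⊕ Fin 1) :
    (((u21FrameEquivFin1 g : UForm (Fin 2) (Fin 1)) : GL (Fin 2 ⊕ Fin 1) ℂ) : Matrix (Fin 2 ⊕ Fin 1) (Fin 2 ⊕ Fin 1) ℂ)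
        x y =
      mat g (frameIdxFin1.symm x) (frameIdxFin1.symm y) :=
  rfl

end Literature.RepresentationTheory.KonnoKonno2007.RealDualPair

namespace Literature.NumberTheory.Automorphic

open Literature.Geometry.ComplexHyperbolic.BallModel (U21 J)
open Literature.RepresentationTheory.KonnoKonno2007 Literature.RepresentationTheory.KonnoKonno2007.RealDualPair
open UnitaryGroup UnitaryGroup.CotangentForms

/-! ## §2 The CM archimedean section on `U(2,1)_{Fin 2 ⊕ Fin 1}` -/

section CMSection

variable (L : Type) [Field L] [NumberField L] [IsCMField L] (ι : L →+* ℂ) (H : Matrix (Fin 3) (Fin 3) L)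
  (T : GL (Fin 3) ℂ) (hT : (T : Matrix (Fin 3) (Fin 3) ℂ)ᴴ * H.map ι * (T : Matrix (Fin 3) (Fin 3) ℂ) = J)

/-- **`cmArchSectionUForm L ι H T hT : U(2,1)_{Fin 2 ⊕ Fin 1} →* U(H)(𝔸_{L⁺})`** — the CM archimedean section at `ι`
through the frame `T` (★ `cmArchSection L ι H T hT : U21 →* U(H)(𝔸_{L⁺})`, = ★ `archSectionU21CM`: the inclusion of the
archimedean factor `U(H^{σ_ι}) ≅ U(2,1)` at the place of `ι`, identity at all other places) precomposed with the inverse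
frame `u21FrameEquivFin1⁻¹ : UForm (Fin 2) (Fin 1) ≃ U21`.  Borel–Jacquet, §4.1 (`G_∞ = ∏_v G_v ↪ G(𝔸)`).
[cite: BorelJacquetCorvallis1979, §4.1 and §4.3] -/
def UnitaryGroup.cmArchSectionUForm :
    (uFormGroup (Fin 2) (Fin 1)).carrier →*
      (adelicGroupData (↥(maximalRealSubfield L)) L (IsCMField.complexConj L) 3 H).Adelic :=
  (cmArchSection L ι H T hT).comp u21FrameEquivFin1.symm.toMulEquiv.toMonoidHom

/-- Unfolding: `cmArchSectionUForm g = cmArchSection (u21FrameEquivFin1⁻¹ g)`. [cite: BorelJacquetCorvallis1979, §4.1] -/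
theorem UnitaryGroup.cmArchSectionUForm_apply (g : (uFormGroup (Fin 2) (Fin 1)).carrier) :
    cmArchSectionUForm L ι H T hT g = cmArchSection L ι H T hT (u21FrameEquivFin1.symm g) := rfl

/-- On the frame image: `cmArchSectionUForm (u21FrameEquivFin1 u) = cmArchSection u` for `u ∈ U21`.
[cite: BorelJacquetCorvallis1979, §4.1] -/
@[simp] theorem UnitaryGroup.cmArchSectionUForm_apply_u21FrameEquivFin1 (u : U21) :
    cmArchSectionUForm L ι H T hT (u21FrameEquivFin1 u) = cmArchSection L ι H T hT u := by
  rw [cmArchSectionUForm_apply, ContinuousMulEquiv.symm_apply_apply]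

/-- `cmArchSectionUForm` is continuous (★ `continuous_archSectionU21CM` and continuity of the frame).
[cite: BorelJacquetCorvallis1979, §4.1] -/
theorem UnitaryGroup.continuous_cmArchSectionUForm : Continuous (cmArchSectionUForm L ι H T hT) :=
  (continuous_archSectionU21CM L ι H T hT).comp u21FrameEquivFin1.symm.continuous

/-- `cmArchSectionUForm` is injective (★ `cmArchSection_injective`). [cite: BorelJacquetCorvallis1979, §4.1] -/
theorem UnitaryGroup.cmArchSectionUForm_injective : Function.Injective (cmArchSectionUForm L ι H T hT) :=
  (cmArchSection_injective L ι H T hT).comp u21FrameEquivFin1.symm.injective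

end CMSection

/-! ## §3 The archimedean `(𝔤, K)`-module of `P` at `ι` in the `uFormGroup (Fin 2) (Fin 1)` currency -/

section CMArchModule

variable {L : Type} [Field L] [NumberField L] [IsCMField L] (ι : L →+* ℂ) {H : Matrix (Fin 3) (Fin 3) L}
  (T : GL (Fin 3) ℂ) (hT : (T : Matrix (Fin 3) (Fin 3) ℂ)ᴴ * H.map ι * (T : Matrix (Fin 3) (Fin 3) ℂ) = J)
  {μ : Measure (adelicGroupData (↥(maximalRealSubfield L)) L (IsCMField.complexConj L) 3 H).automorphicQuotient}
  [(adelicGroupData (↥(maximalRealSubfield L)) L (IsCMField.complexConj L) 3 H).IsAutomorphicMeasure μ]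
  (P : DiscreteAutomorphicRep (adelicGroupData (↥(maximalRealSubfield L)) L (IsCMField.complexConj L) 3 H) μ)

/-- **`P.archRepCM ι T hT` — the restriction of `P` to `U(2,1)_{Fin 2 ⊕ Fin 1}` at the place of `ι`**
(`= P.archRep (uFormGroup (Fin 2) (Fin 1)) (cmArchSectionUForm L ι H T hT)`). [cite: BorelJacquetCorvallis1979, §4.3 and §4.6] -/
abbrev DiscreteAutomorphicRep.archRepCM :
    ContRepresentation ℂ (uFormGroup (Fin 2) (Fin 1)).carrier P.space.toSubmodule :=
  P.archRep (uFormGroup (Fin 2) (Fin 1)) (cmArchSectionUForm L ι H T hT)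

/-- **`P.archModuleCM ι T hT` — the archimedean `(𝔤, K)`-module of `P` at `ι`**: the smooth `K`-finite vectors of
`P|_{U(2,1)}` along the CM section at `ι` (`= P.archModule (uFormGroup (Fin 2) (Fin 1)) (cmArchSectionUForm L ι H T hT)`),
`K = U(2,1) ∩ U(3) ≅ U(2) × U(1)`.  Borel–Wallach Ch. 0 §2.4 (`V₀ = V^∞ ∩ V_(K)`); Borel–Jacquet §4.3–4.6.
[cite: BorelWallach2000, Ch. 0 §2.4 and §2.6 (pp. 3–4)] [cite: BorelJacquetCorvallis1979, §4.3 and §4.6] -/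
abbrev DiscreteAutomorphicRep.archModuleCM : Submodule ℂ P.space.toSubmodule :=
  P.archModule (uFormGroup (Fin 2) (Fin 1)) (cmArchSectionUForm L ι H T hT)

/-- **`P.archRepKCM ι T hT` — the `K`-action on the archimedean module at `ι`** (`K = (uFormGroup (Fin 2) (Fin 1)).maximalCompact`).
[cite: BorelWallach2000, Ch. 0 §2.4–2.6 (pp. 3–4)] -/
abbrev DiscreteAutomorphicRep.archRepKCM :
    Representation ℂ (uFormGroup (Fin 2) (Fin 1)).maximalCompact (P.archModuleCM ι T hT) :=
  P.archRepK (uFormGroup (Fin 2) (Fin 1)) (cmArchSectionUForm L ι H T hT)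

/-- **`P.archRepLieCM ι T hT` — the derived `𝔲(2,1)`-action on the archimedean module at `ι`** (the explicit differential
along the continuous section `cmArchSectionUForm`). [cite: BorelWallach2000, Ch. 0 §2.4 and §2.6 (pp. 3–4)] -/
abbrev DiscreteAutomorphicRep.archRepLieCM :
    (uFormGroup (Fin 2) (Fin 1)).lie →ₗ⁅ℝ⁆ Module.End ℂ (P.archModuleCM ι T hT) :=
  P.archRepLie (uFormGroup (Fin 2) (Fin 1)) (cmArchSectionUForm L ι H T hT) (continuous_cmArchSectionUForm L ι H T hT)

/-- `P.archRepCM ι T hT (u21FrameEquivFin1 u) v = R(cmArchSection u) v` in `L²`: on the frame image the restricted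
representation is `P` along the CM section ★ `cmArchSection`. [cite: BorelJacquetCorvallis1979, §4.3] -/
theorem DiscreteAutomorphicRep.coe_archRepCM_apply_u21FrameEquivFin1 (u : U21) (v : P.space.toSubmodule) :
    ((P.archRepCM ι T hT (u21FrameEquivFin1 u) v : P.space.toSubmodule) :
        (adelicGroupData (↥(maximalRealSubfield L)) L (IsCMField.complexConj L) 3 H).L2 μ) =
      (adelicGroupData (↥(maximalRealSubfield L)) L (IsCMField.complexConj L) 3 H).rightRegular μ
        (cmArchSection L ι H T hT u) v := by
  rw [DiscreteAutomorphicRep.coe_archRep_apply, cmArchSectionUForm_apply_u21FrameEquivFin1]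

/-- **The archimedean module at `ι` is a `(𝔤, K)`-module of `U(2,1)_{Fin 2 ⊕ Fin 1}`** (★ `isGKModule_archModule`).
[cite: BorelWallach2000, Ch. 0 §2.6 (pp. 3–4)] [cite: BorelJacquetCorvallis1979, §4.6] -/
theorem DiscreteAutomorphicRep.isGKModule_archModuleCM :
    IsGKModule (uFormGroup (Fin 2) (Fin 1)) (P.archRepKCM ι T hT) (P.archRepLieCM ι T hT) :=
  P.isGKModule_archModule _ _ _

/-- The archimedean module at `ι` IS the Harish-Chandra module of `P|_{U(2,1)}` (derivative formula).
[cite: BorelWallach2000, Ch. 0 §2.4 and §2.6 (pp. 3–4)] -/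
theorem DiscreteAutomorphicRep.isHarishChandraModuleOf_archModuleCM :
    IsHarishChandraModuleOf (uFormGroup (Fin 2) (Fin 1)) (P.archRepCM ι T hT) (P.archModuleCM ι T hT)
      (P.archRepLieCM ι T hT) :=
  P.isHarishChandraModuleOf_archModule _ _ _

/-- **Unitarity of the archimedean module at `ι`**: `⟪X·v, w⟫ + ⟪v, X·w⟫ = 0` for `v, w ∈ P.archModuleCM ι T hT`,
`X ∈ 𝔲(2,1)` (★ `inner_archRepLie_add_inner_archRepLie_eq_zero`). [cite: BorelWallach2000, Ch. 0 §2.5–2.6 (pp. 3–4)] -/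
theorem DiscreteAutomorphicRep.inner_archRepLieCM_add_inner_archRepLieCM_eq_zero
    (X : (uFormGroup (Fin 2) (Fin 1)).lie) (v w : P.archModuleCM ι T hT) :
    ⟪((P.archRepLieCM ι T hT X v : P.archModuleCM ι T hT) : P.space.toSubmodule), (w : P.space.toSubmodule)⟫_ℂ +
        ⟪(v : P.space.toSubmodule), ((P.archRepLieCM ι T hT X w : P.archModuleCM ι T hT) : P.space.toSubmodule)⟫_ℂ =
      0 :=
  P.inner_archRepLie_add_inner_archRepLie_eq_zero _ _ _ X v w

/-- `K` acts isometrically on the archimedean module at `ι`. [cite: BorelWallach2000, Ch. 0 §2.5 (pp. 3–4)] -/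
theorem DiscreteAutomorphicRep.norm_archRepKCM_apply (k : (uFormGroup (Fin 2) (Fin 1)).maximalCompact)
    (v : P.archModuleCM ι T hT) :
    ‖((P.archRepKCM ι T hT k v : P.archModuleCM ι T hT) : P.space.toSubmodule)‖ = ‖(v : P.space.toSubmodule)‖ :=
  P.norm_archRepK_apply _ _ k v

end CMArchModule

end Literature.NumberTheory.Automorphic
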